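import Summits.HodgeConjecture.HodgeConjecture.Theorems.MarkmanPartnerTransportPartnerExistenceBBFPositivity
import Literature.AlgebraicGeometry.HodgeTheory.AbelianVarietyEndomorphismsHOne
import Literature.AlgebraicGeometry.HodgeTheory.LefschetzOneOneHolds
import Literature.AlgebraicGeometry.HodgeTheory.AlgebraicClassesHodgeTypeHolds

/-!
# Route MarkmanPartnerTransport · support `PartnerExistence` (stmt-HodgeConjecture-19655) —
# the Beauville–Bogomolov form is NON-DEGENERATE on `N¹(X)` for every marked `K3^{[2]}`-type fourfold

Consequence of `…PartnerExistenceBBFPositivity` (Beauville–Fujiki positivity `q(κ) > 0` and the Hodge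
index inequality `q(d,d) < 0` for real `(1,1)`-classes `d ≠ 0` with `q(κ,d) = 0`): **for a marked smooth
projective fourfold `(X, φ, P, z)` (clauses (m1)–(m6)), the form `q(φ·, φ·)` restricted to
`N¹(X) = algebraicClasses X 1` has trivial radical.** Proof: the Kähler class `κ = H_η` of a
Kähler–rational datum (`nonempty_kaehlerRationalDatum`) lies in `N¹(X)` (Lefschetz (1,1),
`lefschetzOneOne_rational_holds`); `N¹(X)` is stable under complex conjugation
(`conjClass_mem_algebraicClasses`) and consists of `(1,1)`-classes; a class `c` in the radical has real and
imaginary parts `a = c + c̄`, `b = i(c − c̄)` in the radical, each real, of type `(1,1)`, `q`-orthogonal to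
`κ` and `q`-isotropic — so `a = b = 0` by the Hodge index inequality, and `c = 0`. This is the hidden
hypothesis of `PartnerExistence` (its `g` is an isometry of the non-degenerate `T(S)` onto `N¹(X)^{⊥_q}`),
now a theorem (evidence #1/#2 on stmt-19655).

* `k3HilbertForm_radical_algebraicClasses_one_eq_zero` — the statement above.

No definition, no sorry, no named fact. Prover seat hodge-nonav-19652-p1 (gen 5), `--supports stmt-HodgeConjecture-19655`.

References: A. Beauville, J. Differential Geom. 18 (1983) §8 Thm. 5; C. Voisin, *Hodge Theory I*, §6.3.2
Thm. 6.32 and Thm. 11.30 (Lefschetz (1,1)).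
-/

noncomputable section

set_option linter.dupNamespace false

open Module CategoryTheory
open Literature.AlgebraicTopology.SingularHomology Literature.Geometry.Kaehler
open Literature.AlgebraicGeometry Literature.AlgebraicGeometry.Motives Literature.AlgebraicGeometry.HodgeTheory
open Literature.AlgebraicGeometry.Hyperkaehler Literature.AlgebraicGeometry.Surfaces
open Summit.HodgeConjecture.HodgeConjecture.Theorems.NikulinTwinTransport

namespace Summit.HodgeConjecture.HodgeConjecture.Theorems.MarkmanPartnerTransport.BBFPositivity

variable {X : SchemeOver ℂ}

/-- `MarkedK3Sq[X, φ, P, z]`: VERBATIM the `let MarkedK3Sq := …` binder of the route declarations of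
MarkmanPartnerTransport (clauses (m1)–(m6)). Local notation only. -/
local notation3 (prettyPrint := false) "MarkedK3Sq[" X ", " φ ", " P ", " z "]" =>
  (((IsIntegralClass P ∧ ∀ Q : complexBetti X (2 * 4), IsIntegralClass Q → ∃ n : ℤ, Q = n • P) ∧
    (∀ c : complexBetti X 2, IsIntegralClass c ↔ ∃ v : K3HilbertIndex → ℤ, φ c = fun i => (v i : ℂ)) ∧
    (∀ a : complexBetti X 2, cupPowTwo a 4 = ((3 : ℂ) * (k3HilbertForm 2 (φ a) (φ a)) ^ 2) • P) ∧
    (IsOfHodgeType 4 X 2 2 0 (LinearEquiv.symm φ z) ∧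
      ∀ τ : complexBetti X 2, IsOfHodgeType 4 X 2 2 0 τ → ∃ t : ℂ, τ = t • LinearEquiv.symm φ z) ∧
    (∀ c : complexBetti X 2, IsOfHodgeType 4 X 2 1 1 c ↔
      (k3HilbertForm 2 (φ c) z = 0 ∧ k3HilbertForm 2 (φ c) (star z) = 0)) ∧
    (k3HilbertForm 2 z z = 0 ∧ 0 < (k3HilbertForm 2 (star z) z).re)))

/-! ### Non-degeneracy on `N¹(X)` -/

/-- **The Beauville–Bogomolov form has trivial radical on `N¹(X)`** for every marked smooth projective
fourfold (module docstring). [cite: Beauville1983, §8 Thm. 5] [cite: VoisinHodgeI2002, §6.3.2 Thm. 6.32 and Thm. 11.30] -/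
theorem k3HilbertForm_radical_algebraicClasses_one_eq_zero (hX : IsSmoothProjective 4 X)
    {φ : complexBetti X 2 ≃ₗ[ℂ] (K3HilbertIndex → ℂ)} {P : complexBetti X (2 * 4)} {z : K3HilbertIndex → ℂ}
    (hM : MarkedK3Sq[X, φ, P, z]) {c : complexBetti X 2} (hc : c ∈ algebraicClasses X 1)
    (hperp : ∀ d ∈ algebraicClasses X 1, k3HilbertForm 2 (φ c) (φ d) = 0) : c = 0 := by
  obtain ⟨D⟩ := nonempty_kaehlerRationalDatum hX
  obtain ⟨-, hint, -⟩ := id hM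
  set N : Submodule ℂ (complexBetti X 2) := algebraicClasses X 1 with hNdef
  have hκN : D.Hη ∈ N := lefschetzOneOne_rational_holds hX D.Hη D.isRationalClass_Hη D.isOfHodgeType_Hη
  have hconjN : ∀ d ∈ N, conjClass (ComplexPoints X) 2 d ∈ N := fun d hd ↦
    conjClass_mem_algebraicClasses hX (p := 1) hd
  have h11N : ∀ d ∈ N, IsOfHodgeType 4 X 2 1 1 d := fun d hd ↦
    isOfHodgeType_of_mem_algebraicClasses_of_isSmoothProjective hX 1 hd
  -- the conjugate of `c` is also in the radical
  have hperp' : ∀ d ∈ N, k3HilbertForm 2 (φ (conjClass (ComplexPoints X) 2 c)) (φ d) = 0 := by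
    intro d hd
    have h := hperp _ (hconjN d hd)
    rw [marking_conjClass hint] at h ⊢
    have h2 : star (k3HilbertForm 2 (φ c) (star (φ d))) = 0 := by rw [h, star_zero]
    rwa [star_k3HilbertForm, star_star] at h2
  -- real and imaginary parts
  set a : complexBetti X 2 := c + conjClass (ComplexPoints X) 2 c with hadef
  set b : complexBetti X 2 := Complex.I • (c - conjClass (ComplexPoints X) 2 c) with hbdef
  have hcbar : conjClass (ComplexPoints X) 2 c ∈ N := hconjN c hc
  have haN : a ∈ N := N.add_mem hc hcbar
  have hbN : b ∈ N := N.smul_mem _ (N.sub_mem hc hcbar)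
  have hareal : conjClass (ComplexPoints X) 2 a = a := by
    rw [hadef, conjClass_add, conjClass_conjClass, add_comm]
  have hbreal : conjClass (ComplexPoints X) 2 b = b := by
    rw [hbdef, conjClass_smul, conjClass_sub, conjClass_conjClass, Complex.conj_I, neg_smul, ← smul_neg,
      neg_sub]
  have haperp : ∀ d ∈ N, k3HilbertForm 2 (φ a) (φ d) = 0 := fun d hd ↦ by
    rw [hadef, map_add, k3HilbertForm_add_left, hperp d hd, hperp' d hd, add_zero]
  have hbperp : ∀ d ∈ N, k3HilbertForm 2 (φ b) (φ d) = 0 := fun d hd ↦ by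
    rw [hbdef, map_smul, k3HilbertForm_smul_left, map_sub, sub_eq_add_neg, ← neg_one_smul ℂ,
      k3HilbertForm_add_left, k3HilbertForm_smul_left, hperp d hd, hperp' d hd]
    ring
  -- each real isotropic `(1,1)`-class orthogonal to `κ` in `N¹` vanishes
  have hzero : ∀ e ∈ N, conjClass (ComplexPoints X) 2 e = e →
      (∀ d ∈ N, k3HilbertForm 2 (φ e) (φ d) = 0) → e = 0 := by
    intro e heN hereal heperp
    by_contra he0
    have hκe : k3HilbertForm 2 (φ D.Hη) (φ e) = 0 := by rw [k3HilbertForm_comm]; exact heperp _ hκN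
    have h := (k3HilbertForm_self_neg_of_oneOne_of_kaehler_orthogonal hX hM D (h11N e heN) hereal he0 hκe).1
    rw [heperp e heN, Complex.zero_re] at h
    exact lt_irrefl _ h
  have ha0 : a = 0 := hzero a haN hareal haperp
  have hb0 : b = 0 := hzero b hbN hbreal hbperp
  -- `2c = a - i b`
  have h2c : (2 : ℂ) • c = a - Complex.I • b := by
    rw [hadef, hbdef, smul_smul, Complex.I_mul_I, neg_one_smul, sub_neg_eq_add, two_smul]
    abel
  rw [ha0, hb0, smul_zero, sub_zero] at h2c
  rcases smul_eq_zero.1 h2c with h | h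
  · norm_num at h
  · exact h

end Summit.HodgeConjecture.HodgeConjecture.Theorems.MarkmanPartnerTransport.BBFPositivity

end
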